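import Summits.HubbardSuperconductivity.HubbardSuperconductivity.Theorems.JosephsonMirrorJmInterchangeRateFormTools

/-!
# Route `JosephsonMirror` — crux `JmInterchange` (stmt-HubbardSuperconductivity-2227), line `Sketch`:
# the floor data of the Hubbard torus for the rate-form interchange

Helper file (lead c2).  `floorProjectionData`: on `hubbardTorus 2 L 1 U` with `4 ≤ N`, let `P = P₁ + P₂` be the sum of
the orthogonal projections onto the two sector ground floors `G(N, 0)`, `G(N - 2, 0)` (orthogonal subspaces of different
particle number).  Then `P` is a Hermitian contraction; a gap `γ` above each floor inside its sector becomes the gap in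
VARIANCE form `γ ‖(1 - P) v‖² ≤ Re ⟨v, H v⟩ - e(n) ‖v‖²` on `szSector n 0` (`variance_gap_of_sectorGap`); and a
homogeneous pairing bound `|⟨χ, Δ_d φ⟩|² ≤ L² s ‖χ‖² ‖φ‖²` on the floors becomes the floor-to-floor transfer bounds
`‖P D P v‖², ‖P Dᴴ P v‖² ≤ s ‖v‖²` for `D = L⁻¹ Δ_d` (`P D P = P₂ D P₁`, `P Dᴴ P = P₁ Dᴴ P₂` by particle-number
bookkeeping).  These are the hypotheses of the abstract engine `re_coupling_le_floor_add_leak` as used by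
`Theorems/JosephsonMirrorJmInterchangeRateForm.lean`.

Sources: H. Tasaki (2020) §2.1, App. A.2; T. Kato (1966) I §6.  Folklore linear algebra over the tree's definitions.
No new definitions.
-/

-- the mandated namespace `Summit.<Summit>.<Problem>.Theorems` repeats `HubbardSuperconductivity`
-- (single-problem summit, D-0017), which the `dupNamespace` linter flags on every declaration
set_option linter.dupNamespace false

namespace Summit.HubbardSuperconductivity.HubbardSuperconductivity.Theorems.JosephsonMirror

open Matrix Literature.MathematicalPhysics.QuantumLattice
open Literature.MathematicalPhysics.QuantumLattice.EigenvalueContinuation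
open scoped ComplexOrder

/-- **Floor projection data on the Hubbard torus.**  `H = hubbardTorus 2 L 1 U`, `4 ≤ N`, `e₁, e₂` the sector
minima of `(N, 0)`, `(N - 2, 0)`, `F₁, F₂` the two floors, `Δ = pairField dWaveFormFactor L`, `D = L⁻¹ Δ`.  Given a
gap `γ` above each floor inside its sector and the homogeneous pairing bound `|⟨χ, Δ φ⟩|² ≤ L² s ‖χ‖² ‖φ‖²` for
`φ ∈ F₁`, `χ ∈ F₂`, there is a Hermitian contraction `P` (the projection onto `F₁ ⊕ F₂`) with the gap in variance
form on both sectors and the transfer bounds `‖P D P v‖², ‖P Dᴴ P v‖² ≤ s ‖v‖²`.  Tasaki (2020) §2.1. [folklore] -/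
theorem floorProjectionData (L : ℕ) [NeZero L] (U : ℝ) (N : ℕ) (hN4 : 4 ≤ N) (γ s : ℝ) (hs : 0 ≤ s)
    (hgapH : ∀ n : ℕ, (n = N ∨ n = N - 2) → ∀ w : Fock (Orb (FermionTorus 2 L)), w ∈ szSector n 0 →
      (∀ g : Fock (Orb (FermionTorus 2 L)), IsGroundStateInSector (hubbardTorus 2 L 1 U) n 0 g → star g ⬝ᵥ w = 0) →
        ((hubbardTorus 2 L 1 U).minEnergyOn (szSector n 0) + γ) * (star w ⬝ᵥ w).re ≤
          (star w ⬝ᵥ (hubbardTorus 2 L 1 U *ᵥ w)).re)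
    (hpair : ∀ φ χ : Fock (Orb (FermionTorus 2 L)),
      φ ∈ szSector N 0 ⊓ Module.End.eigenspace (Matrix.toLin' (hubbardTorus 2 L 1 U))
        (((hubbardTorus 2 L 1 U).minEnergyOn (szSector N 0) : ℝ) : ℂ) →
      χ ∈ szSector (N - 2) 0 ⊓ Module.End.eigenspace (Matrix.toLin' (hubbardTorus 2 L 1 U))
        (((hubbardTorus 2 L 1 U).minEnergyOn (szSector (N - 2) 0) : ℝ) : ℂ) →
      ‖star χ ⬝ᵥ (pairField dWaveFormFactor L *ᵥ φ)‖ ^ 2 ≤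
        (L : ℝ) ^ 2 * s * ((star χ ⬝ᵥ χ).re * (star φ ⬝ᵥ φ).re)) :
    ∃ P : Matrix (Finset (Orb (FermionTorus 2 L))) (Finset (Orb (FermionTorus 2 L))) ℂ,
      Pᴴ = P ∧ (∀ v, (star (P *ᵥ v) ⬝ᵥ (P *ᵥ v)).re ≤ (star v ⬝ᵥ v).re) ∧
      (∀ v, v ∈ szSector N 0 → γ * (star ((1 - P) *ᵥ v) ⬝ᵥ ((1 - P) *ᵥ v)).re ≤
        (star v ⬝ᵥ (hubbardTorus 2 L 1 U *ᵥ v)).re -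
          (hubbardTorus 2 L 1 U).minEnergyOn (szSector N 0) * (star v ⬝ᵥ v).re) ∧
      (∀ v, v ∈ szSector (N - 2) 0 → γ * (star ((1 - P) *ᵥ v) ⬝ᵥ ((1 - P) *ᵥ v)).re ≤
        (star v ⬝ᵥ (hubbardTorus 2 L 1 U *ᵥ v)).re -
          (hubbardTorus 2 L 1 U).minEnergyOn (szSector (N - 2) 0) * (star v ⬝ᵥ v).re) ∧
      (∀ v, (star ((P * (((L : ℂ))⁻¹ • pairField dWaveFormFactor L) * P) *ᵥ v) ⬝ᵥ
          ((P * (((L : ℂ))⁻¹ • pairField dWaveFormFactor L) * P) *ᵥ v)).re ≤ s * (star v ⬝ᵥ v).re) ∧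
      (∀ v, (star ((P * (((L : ℂ))⁻¹ • pairField dWaveFormFactor L)ᴴ * P) *ᵥ v) ⬝ᵥ
          ((P * (((L : ℂ))⁻¹ • pairField dWaveFormFactor L)ᴴ * P) *ᵥ v)).re ≤ s * (star v ⬝ᵥ v).re) := by
  set H := hubbardTorus 2 L 1 U with hHdef
  set e₁ : ℝ := H.minEnergyOn (szSector N 0) with he₁
  set e₂ : ℝ := H.minEnergyOn (szSector (N - 2) 0) with he₂
  have hHherm : H.IsHermitian := LiebThm1.hamiltonian_isHermitian (fermionTorusGraph 2 L) 1 U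
  have hL0 : (0 : ℝ) < L := by exact_mod_cast Nat.pos_of_ne_zero (NeZero.ne L)
  have hLne : (L : ℂ) ≠ 0 := by exact_mod_cast (NeZero.ne L)
  -- orthogonality of different particle-number sectors
  have horth : ∀ {p q : ℕ} {u v : Fock (Orb (FermionTorus 2 L))}, u ∈ szSector p 0 → v ∈ szSector q 0 →
      p ≠ q → star u ⬝ᵥ v = 0 := fun hu hv hpq =>
    ThermodynamicLimit.dotProduct_eq_zero_of_isNParticle_ne ((mem_szSector_iff _ _ _).1 hu).1
      ((mem_szSector_iff _ _ _).1 hv).1 hpq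
  -- the two floors and their projections
  set F₁ : Submodule ℂ (Fock (Orb (FermionTorus 2 L))) :=
    szSector N 0 ⊓ Module.End.eigenspace (Matrix.toLin' H) (e₁ : ℂ) with hF₁
  set F₂ : Submodule ℂ (Fock (Orb (FermionTorus 2 L))) :=
    szSector (N - 2) 0 ⊓ Module.End.eigenspace (Matrix.toLin' H) (e₂ : ℂ) with hF₂
  set Q₁ : Matrix (Finset (Orb (FermionTorus 2 L))) (Finset (Orb (FermionTorus 2 L))) ℂ := projMatrix (F₁.map
    ((WithLp.linearEquiv 2 ℂ (Fock (Orb (FermionTorus 2 L)))).symm :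
      (Fock (Orb (FermionTorus 2 L))) →ₗ[ℂ] EuclideanSpace ℂ (Finset (Orb (FermionTorus 2 L))))) with hQ₁
  set Q₂ : Matrix (Finset (Orb (FermionTorus 2 L))) (Finset (Orb (FermionTorus 2 L))) ℂ := projMatrix (F₂.map
    ((WithLp.linearEquiv 2 ℂ (Fock (Orb (FermionTorus 2 L)))).symm :
      (Fock (Orb (FermionTorus 2 L))) →ₗ[ℂ] EuclideanSpace ℂ (Finset (Orb (FermionTorus 2 L))))) with hQ₂
  have hmemF₁ : ∀ u, u ∈ F₁ ↔ u ∈ szSector N 0 ∧ H *ᵥ u = (e₁ : ℂ) • u := fun u => by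
    rw [hF₁, Submodule.mem_inf, Module.End.mem_eigenspace_iff, Matrix.toLin'_apply]
  have hmemF₂ : ∀ u, u ∈ F₂ ↔ u ∈ szSector (N - 2) 0 ∧ H *ᵥ u = (e₂ : ℂ) • u := fun u => by
    rw [hF₂, Submodule.mem_inf, Module.End.mem_eigenspace_iff, Matrix.toLin'_apply]
  have hQ₁H : Q₁ᴴ = Q₁ := (projMatrix_isHermitian _).eq
  have hQ₂H : Q₂ᴴ = Q₂ := (projMatrix_isHermitian _).eq
  have hQ₁Q₁ : Q₁ * Q₁ = Q₁ := projMatrix_mul_self _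
  have hQ₂Q₂ : Q₂ * Q₂ = Q₂ := projMatrix_mul_self _
  have hQ₁mem : ∀ v, Q₁ *ᵥ v ∈ F₁ := fun v => projMatrix_map_mulVec_mem F₁ v
  have hQ₂mem : ∀ v, Q₂ *ᵥ v ∈ F₂ := fun v => projMatrix_map_mulVec_mem F₂ v
  have hQ₁sec : ∀ v, Q₁ *ᵥ v ∈ szSector N 0 := fun v => ((hmemF₁ _).1 (hQ₁mem v)).1
  have hQ₂sec : ∀ v, Q₂ *ᵥ v ∈ szSector (N - 2) 0 := fun v => ((hmemF₂ _).1 (hQ₂mem v)).1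
  -- the projections kill the other sectors
  have hQ₁kill : ∀ {m : ℕ} {v : Fock (Orb (FermionTorus 2 L))}, v ∈ szSector m 0 → m ≠ N → Q₁ *ᵥ v = 0 := by
    intro m v hv hm
    refine projMatrix_map_mulVec_eq_zero_of_orthogonal F₁ fun w hw => ?_
    exact horth ((hmemF₁ w).1 hw).1 hv (Ne.symm hm)
  have hQ₂kill : ∀ {m : ℕ} {v : Fock (Orb (FermionTorus 2 L))}, v ∈ szSector m 0 → m ≠ N - 2 →
      Q₂ *ᵥ v = 0 := by
    intro m v hv hm
    refine projMatrix_map_mulVec_eq_zero_of_orthogonal F₂ fun w hw => ?_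
    exact horth ((hmemF₂ w).1 hw).1 hv (Ne.symm hm)
  have hQ₁Q₂ : Q₁ * Q₂ = 0 := by
    refine Matrix.ext_iff_mulVec.2 fun v => ?_
    rw [← mulVec_mulVec, zero_mulVec]
    exact hQ₁kill (hQ₂sec v) (by omega)
  have hQ₂Q₁ : Q₂ * Q₁ = 0 := by
    refine Matrix.ext_iff_mulVec.2 fun v => ?_
    rw [← mulVec_mulVec, zero_mulVec]
    exact hQ₂kill (hQ₁sec v) (by omega)
  -- the total floor projection
  set P : Matrix (Finset (Orb (FermionTorus 2 L))) (Finset (Orb (FermionTorus 2 L))) ℂ := Q₁ + Q₂ with hP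
  have hPH : Pᴴ = P := by rw [hP, conjTranspose_add, hQ₁H, hQ₂H]
  have hPP : P * P = P := by
    rw [hP, Matrix.add_mul, Matrix.mul_add, Matrix.mul_add, hQ₁Q₁, hQ₁Q₂, hQ₂Q₁, hQ₂Q₂, add_zero, zero_add]
  have hPc : ∀ v, (star (P *ᵥ v) ⬝ᵥ (P *ᵥ v)).re ≤ (star v ⬝ᵥ v).re := re_proj_self_le hPH hPP
  have hPv : ∀ v, P *ᵥ v = Q₁ *ᵥ v + Q₂ *ᵥ v := fun v => by rw [hP, add_mulVec]
  -- (1) the gap in variance form on the two sectors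
  have hgapF : ∀ (m : ℕ) (em : ℝ), em = H.minEnergyOn (szSector m 0) → (m = N ∨ m = N - 2) →
      ∀ w ∈ szSector m 0, (∀ g ∈ szSector m 0, H *ᵥ g = (em : ℂ) • g → star g ⬝ᵥ w = 0) →
        (em + γ) * (star w ⬝ᵥ w).re ≤ (star w ⬝ᵥ H *ᵥ w).re := by
    intro m em hem hm w hw horthw
    have h := hgapH m hm w hw (fun g hg => horthw g hg.1 (by rw [hem]; exact hg.2.2))
    rw [hem]
    exact h
  have hgap₁ : ∀ v, v ∈ szSector N 0 →
      γ * (star ((1 - P) *ᵥ v) ⬝ᵥ ((1 - P) *ᵥ v)).re ≤ (star v ⬝ᵥ H *ᵥ v).re - e₁ * (star v ⬝ᵥ v).re := by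
    intro v hvs
    have h1P : (1 - P) *ᵥ v = v - Q₁ *ᵥ v := by
      rw [sub_mulVec, one_mulVec, hPv, hQ₂kill hvs (by omega), add_zero]
    rw [h1P]
    exact variance_gap_of_sectorGap hHherm (szSector N 0) e₁ γ (hgapF N e₁ rfl (Or.inl rfl)) v hvs
  have hgap₂ : ∀ v, v ∈ szSector (N - 2) 0 →
      γ * (star ((1 - P) *ᵥ v) ⬝ᵥ ((1 - P) *ᵥ v)).re ≤ (star v ⬝ᵥ H *ᵥ v).re - e₂ * (star v ⬝ᵥ v).re := by
    intro v hvs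
    have h1P : (1 - P) *ᵥ v = v - Q₂ *ᵥ v := by
      rw [sub_mulVec, one_mulVec, hPv, hQ₁kill hvs (by omega), zero_add]
    rw [h1P]
    exact variance_gap_of_sectorGap hHherm (szSector (N - 2) 0) e₂ γ (hgapF (N - 2) e₂ rfl (Or.inr rfl)) v hvs
  -- (2) the pair field between sectors; `D = L⁻¹ Δ`, `Dᴴ = L⁻¹ Δᴴ`
  set Δ : Matrix (Finset (Orb (FermionTorus 2 L))) (Finset (Orb (FermionTorus 2 L))) ℂ :=
    pairField dWaveFormFactor L with hΔ
  set D : Matrix (Finset (Orb (FermionTorus 2 L))) (Finset (Orb (FermionTorus 2 L))) ℂ := ((L : ℂ))⁻¹ • Δ with hD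
  have hDΔ : ∀ v, D *ᵥ v = ((L : ℂ))⁻¹ • (Δ *ᵥ v) := fun v => by rw [hD, smul_mulVec]
  have hstarL : star (((L : ℂ))⁻¹) = ((L : ℂ))⁻¹ := by
    rw [Complex.star_def, map_inv₀, Complex.conj_natCast]
  have hDhΔ : ∀ v, Dᴴ *ᵥ v = ((L : ℂ))⁻¹ • (Δᴴ *ᵥ v) := fun v => by
    rw [hD, conjTranspose_smul, smul_mulVec, hstarL]
  have hΔsec : ∀ {m : ℕ} {v : Fock (Orb (FermionTorus 2 L))}, 2 ≤ m → v ∈ szSector m 0 →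
      Δ *ᵥ v ∈ szSector (m - 2) 0 := by
    intro m v hm hv
    have h := WcbcsSsbToTorusLRO.pairFieldAt_mulVec_mem_szSector dWaveFormFactor
      (0 : Literature.Probability.LatticeModels.TorusSite 2 L) hm hv
    rwa [pairFieldAt_zero] at h
  have hΔhsec : ∀ {m : ℕ} {v : Fock (Orb (FermionTorus 2 L))}, v ∈ szSector m 0 →
      Δᴴ *ᵥ v ∈ szSector (m + 2) 0 := by
    intro m v hv
    have h := WcbcsSsbToTorusLRO.conjTranspose_pairFieldAt_mulVec_mem_szSector dWaveFormFactor
      (0 : Literature.Probability.LatticeModels.TorusSite 2 L) hv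
    rwa [pairFieldAt_zero] at h
  have hDsec : ∀ {m : ℕ} {v : Fock (Orb (FermionTorus 2 L))}, 2 ≤ m → v ∈ szSector m 0 →
      D *ᵥ v ∈ szSector (m - 2) 0 :=
    fun hm hv => by rw [hDΔ]; exact Submodule.smul_mem _ _ (hΔsec hm hv)
  have hDhsec : ∀ {m : ℕ} {v : Fock (Orb (FermionTorus 2 L))}, v ∈ szSector m 0 →
      Dᴴ *ᵥ v ∈ szSector (m + 2) 0 :=
    fun hv => by rw [hDhΔ]; exact Submodule.smul_mem _ _ (hΔhsec hv)
  -- (3) the transfer bounds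
  have hnormsq : ∀ u : Fock (Orb (FermionTorus 2 L)), ‖star u ⬝ᵥ u‖ = (star u ⬝ᵥ u).re := fun u => by
    have h0 : (0 : ℂ) ≤ star u ⬝ᵥ u := dotProduct_star_self_nonneg u
    rw [Complex.nonneg_iff] at h0
    rw [← Complex.abs_re_eq_norm.2 h0.2.symm, abs_of_nonneg h0.1]
  have hnn : ∀ u : Fock (Orb (FermionTorus 2 L)), 0 ≤ (star u ⬝ᵥ u).re := fun u =>
    (Complex.nonneg_iff.1 (dotProduct_star_self_nonneg u)).1
  have hdiv : ∀ r q : ℝ, 0 ≤ r → 0 ≤ q → (L : ℝ) ^ 2 * r ^ 2 ≤ (L : ℝ) ^ 2 * s * (r * q) → r ≤ s * q := by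
    intro r q hr hq h
    rcases hr.eq_or_lt with hr0 | hrpos
    · rw [← hr0]; positivity
    · have h2 : 0 < (L : ℝ) ^ 2 * r := by positivity
      have h3 : (L : ℝ) ^ 2 * r * r ≤ (L : ℝ) ^ 2 * r * (s * q) := by nlinarith
      exact le_of_mul_le_mul_left h3 h2
  -- lowering direction: `x ∈ F₂`, `f ∈ F₁`, `⟨x, Δ f⟩ = L ‖x‖²`
  have htransfer : ∀ (f x : Fock (Orb (FermionTorus 2 L))), f ∈ F₁ → x ∈ F₂ →
      star x ⬝ᵥ (Δ *ᵥ f) = (L : ℂ) * (star x ⬝ᵥ x) → (star x ⬝ᵥ x).re ≤ s * (star f ⬝ᵥ f).re := by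
    intro f x hf hx hxf
    have hp := hpair f x hf hx
    rw [hxf, norm_mul, Complex.norm_natCast, hnormsq, mul_pow] at hp
    exact hdiv _ _ (hnn x) (hnn f) hp
  -- raising direction: `y ∈ F₁`, `g ∈ F₂`, `⟨g, Δ y⟩ = L ‖y‖²`
  have htransfer' : ∀ (y g : Fock (Orb (FermionTorus 2 L))), y ∈ F₁ → g ∈ F₂ →
      star g ⬝ᵥ (Δ *ᵥ y) = (L : ℂ) * (star y ⬝ᵥ y) → (star y ⬝ᵥ y).re ≤ s * (star g ⬝ᵥ g).re := by
    intro y g hy hg hyg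
    have hp := hpair y g hy hg
    rw [hyg, norm_mul, Complex.norm_natCast, hnormsq, mul_pow,
      mul_comm ((star g ⬝ᵥ g).re) ((star y ⬝ᵥ y).re)] at hp
    exact hdiv _ _ (hnn y) (hnn g) hp
  have hs₁ : ∀ v, (star ((P * D * P) *ᵥ v) ⬝ᵥ ((P * D * P) *ᵥ v)).re ≤ s * (star v ⬝ᵥ v).re := by
    intro v
    -- `P D P v = Q₂ D Q₁ v`
    have hDQ₁ : D *ᵥ (Q₁ *ᵥ v) ∈ szSector (N - 2) 0 := hDsec (by omega) (hQ₁sec v)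
    have hDQ₂ : D *ᵥ (Q₂ *ᵥ v) ∈ szSector (N - 2 - 2) 0 := hDsec (by omega) (hQ₂sec v)
    have hred : (P * D * P) *ᵥ v = Q₂ *ᵥ (D *ᵥ (Q₁ *ᵥ v)) := by
      rw [← mulVec_mulVec, ← mulVec_mulVec, hPv v, mulVec_add, hPv, mulVec_add, mulVec_add,
        hQ₁kill hDQ₁ (by omega), hQ₁kill hDQ₂ (by omega), hQ₂kill hDQ₂ (by omega)]
      simp only [zero_add, add_zero]
    rw [hred]
    have hfF : Q₁ *ᵥ v ∈ F₁ := hQ₁mem v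
    have hfle : (star (Q₁ *ᵥ v) ⬝ᵥ (Q₁ *ᵥ v)).re ≤ (star v ⬝ᵥ v).re := re_proj_self_le hQ₁H hQ₁Q₁ v
    generalize Q₁ *ᵥ v = f at hfF hfle ⊢
    have hxF : Q₂ *ᵥ (D *ᵥ f) ∈ F₂ := hQ₂mem _
    have hxx : star (Q₂ *ᵥ (D *ᵥ f)) ⬝ᵥ (D *ᵥ f) = star (Q₂ *ᵥ (D *ᵥ f)) ⬝ᵥ (Q₂ *ᵥ (D *ᵥ f)) :=
      star_proj_dotProduct hQ₂H hQ₂Q₂ _ _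
    generalize Q₂ *ᵥ (D *ᵥ f) = x at hxF hxx ⊢
    have hxf : star x ⬝ᵥ (Δ *ᵥ f) = (L : ℂ) * (star x ⬝ᵥ x) := by
      have h : star x ⬝ᵥ (D *ᵥ f) = ((L : ℂ))⁻¹ * (star x ⬝ᵥ (Δ *ᵥ f)) := by
        rw [hDΔ f, dotProduct_smul, smul_eq_mul]
      rw [← hxx, h, ← mul_assoc, mul_inv_cancel₀ hLne, one_mul]
    exact (htransfer f x hfF hxF hxf).trans (mul_le_mul_of_nonneg_left hfle hs)
  have hs₂ : ∀ v, (star ((P * Dᴴ * P) *ᵥ v) ⬝ᵥ ((P * Dᴴ * P) *ᵥ v)).re ≤ s * (star v ⬝ᵥ v).re := by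
    intro v
    -- `P Dᴴ P v = Q₁ Dᴴ Q₂ v`
    have hDQ₁ : Dᴴ *ᵥ (Q₁ *ᵥ v) ∈ szSector (N + 2) 0 := hDhsec (hQ₁sec v)
    have hDQ₂ : Dᴴ *ᵥ (Q₂ *ᵥ v) ∈ szSector (N - 2 + 2) 0 := hDhsec (hQ₂sec v)
    have hred : (P * Dᴴ * P) *ᵥ v = Q₁ *ᵥ (Dᴴ *ᵥ (Q₂ *ᵥ v)) := by
      rw [← mulVec_mulVec, ← mulVec_mulVec, hPv v, mulVec_add, hPv, mulVec_add, mulVec_add,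
        hQ₁kill hDQ₁ (by omega), hQ₂kill hDQ₁ (by omega), hQ₂kill hDQ₂ (by omega)]
      simp only [zero_add, add_zero]
    rw [hred]
    have hgF : Q₂ *ᵥ v ∈ F₂ := hQ₂mem v
    have hgle : (star (Q₂ *ᵥ v) ⬝ᵥ (Q₂ *ᵥ v)).re ≤ (star v ⬝ᵥ v).re := re_proj_self_le hQ₂H hQ₂Q₂ v
    generalize Q₂ *ᵥ v = g at hgF hgle ⊢
    have hyF : Q₁ *ᵥ (Dᴴ *ᵥ g) ∈ F₁ := hQ₁mem _
    have h1 : star g ⬝ᵥ (Δ *ᵥ (Q₁ *ᵥ (Dᴴ *ᵥ g))) = star (Δᴴ *ᵥ g) ⬝ᵥ (Q₁ *ᵥ (Dᴴ *ᵥ g)) :=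
      (dotProduct_mulVec (star g) Δ _).trans (by rw [star_mulVec, conjTranspose_conjTranspose])
    have h2 : star (Dᴴ *ᵥ g) ⬝ᵥ (Q₁ *ᵥ (Dᴴ *ᵥ g)) =
        star (Q₁ *ᵥ (Dᴴ *ᵥ g)) ⬝ᵥ (Q₁ *ᵥ (Dᴴ *ᵥ g)) :=
      calc star (Dᴴ *ᵥ g) ⬝ᵥ (Q₁ *ᵥ (Dᴴ *ᵥ g))
          = star (star (Q₁ *ᵥ (Dᴴ *ᵥ g)) ⬝ᵥ (Dᴴ *ᵥ g)) := star_dotProduct _ _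
        _ = star (star (Q₁ *ᵥ (Dᴴ *ᵥ g)) ⬝ᵥ (Q₁ *ᵥ (Dᴴ *ᵥ g))) :=
          congrArg star (star_proj_dotProduct hQ₁H hQ₁Q₁ _ _)
        _ = star (Q₁ *ᵥ (Dᴴ *ᵥ g)) ⬝ᵥ (Q₁ *ᵥ (Dᴴ *ᵥ g)) := (star_dotProduct _ _).symm
    have h3 : Δᴴ *ᵥ g = (L : ℂ) • (Dᴴ *ᵥ g) := by
      have h := congrArg (fun w => (L : ℂ) • w) (hDhΔ g)
      simp only [smul_smul, mul_inv_cancel₀ hLne, one_smul] at h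
      exact h.symm
    have hyg : star g ⬝ᵥ (Δ *ᵥ (Q₁ *ᵥ (Dᴴ *ᵥ g))) =
        (L : ℂ) * (star (Q₁ *ᵥ (Dᴴ *ᵥ g)) ⬝ᵥ (Q₁ *ᵥ (Dᴴ *ᵥ g))) := by
      calc star g ⬝ᵥ (Δ *ᵥ (Q₁ *ᵥ (Dᴴ *ᵥ g))) = star (Δᴴ *ᵥ g) ⬝ᵥ (Q₁ *ᵥ (Dᴴ *ᵥ g)) := h1
        _ = star ((L : ℂ) • (Dᴴ *ᵥ g)) ⬝ᵥ (Q₁ *ᵥ (Dᴴ *ᵥ g)) :=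
          congrArg (fun w => star w ⬝ᵥ (Q₁ *ᵥ (Dᴴ *ᵥ g))) h3
        _ = star (L : ℂ) * (star (Dᴴ *ᵥ g) ⬝ᵥ (Q₁ *ᵥ (Dᴴ *ᵥ g))) := by
          simp only [star_smul, smul_dotProduct, smul_eq_mul]
        _ = (L : ℂ) * (star (Q₁ *ᵥ (Dᴴ *ᵥ g)) ⬝ᵥ (Q₁ *ᵥ (Dᴴ *ᵥ g))) := by
          rw [h2, Complex.star_def, Complex.conj_natCast]
    exact (htransfer' (Q₁ *ᵥ (Dᴴ *ᵥ g)) g hyF hgF hyg).trans (mul_le_mul_of_nonneg_left hgle hs)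
  exact ⟨P, hPH, hPc, hgap₁, hgap₂, hs₁, hs₂⟩

/-- **Registered form** (sub-goal `floorProjectionDataClosed` of line `Sketch`, crux `JmInterchange`): the statement of
`floorProjectionData` as one closed proposition, so that the ledger can match it by name and signature. [folklore] -/
theorem floorProjectionDataClosed : ∀ (L : ℕ) [NeZero L] (U : ℝ) (N : ℕ), 4 ≤ N → ∀ (γ s : ℝ), 0 ≤ s → (∀ n : ℕ, (n = N ∨ n = N - 2) → ∀ w : Fock (Orb (FermionTorus 2 L)), w ∈ szSector n 0 → (∀ g : Fock (Orb (FermionTorus 2 L)), IsGroundStateInSector (hubbardTorus 2 L 1 U) n 0 g → star g ⬝ᵥ w = 0) → ((hubbardTorus 2 L 1 U).minEnergyOn (szSector n 0) + γ) * (star w ⬝ᵥ w).re ≤ (star w ⬝ᵥ (hubbardTorus 2 L 1 U *ᵥ w)).re) → (∀ φ χ : Fock (Orb (FermionTorus 2 L)), φ ∈ szSector N 0 ⊓ Module.End.eigenspace (Matrix.toLin' (hubbardTorus 2 L 1 U)) (((hubbardTorus 2 L 1 U).minEnergyOn (szSector N 0) : ℝ) : ℂ) → χ ∈ szSector (N -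 2) 0 ⊓ Module.End.eigenspace (Matrix.toLin' (hubbardTorus 2 L 1 U)) (((hubbardTorus 2 L 1 U).minEnergyOn (szSector (N - 2) 0) : ℝ) : ℂ) → ‖star χ ⬝ᵥ (pairField dWaveFormFactor L *ᵥ φ)‖ ^ 2 ≤ (L : ℝ) ^ 2 * s * ((star χ ⬝ᵥ χ).re * (star φ ⬝ᵥ φ).re)) → ∃ P : Matrix (Finset (Orb (FermionTorus 2 L))) (Finset (Orb (FermionTorus 2 L))) ℂ, Pᴴ = P ∧ (∀ v, (star (P *ᵥ v) ⬝ᵥ (P *ᵥ v)).re ≤ (star v ⬝ᵥ v).re) ∧ (∀ v, v ∈ szSector N 0 → γ * (star ((1 - P) *ᵥ v) ⬝ᵥ ((1 - P) *ᵥ v)).re ≤ (star v ⬝ᵥ (hubbardTorus 2 L 1 U *ᵥ v)).re - (hubbardTorus 2 L 1 U).minEnergyOn (szSector N 0) * (star v ⬝ᵥ v).re) ∧ (∀ v, v ∈ szSector (N - 2) 0 → γ * (star ((1 - P) *ᵥ v) ⬝ᵥ ((1 - P) *ᵥ v)).re ≤ (star v ⬝ᵥ (hubbardTorus 2 L 1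 U *ᵥ v)).re - (hubbardTorus 2 L 1 U).minEnergyOn (szSector (N - 2) 0) * (star v ⬝ᵥ v).re) ∧ (∀ v, (star ((P * (((L : ℂ))⁻¹ • pairField dWaveFormFactor L) * P) *ᵥ v) ⬝ᵥ ((P * (((L : ℂ))⁻¹ • pairField dWaveFormFactor L) * P) *ᵥ v)).re ≤ s * (star v ⬝ᵥ v).re) ∧ (∀ v, (star ((P * (((L : ℂ))⁻¹ • pairField dWaveFormFactor L)ᴴ * P) *ᵥ v) ⬝ᵥ ((P * (((L : ℂ))⁻¹ • pairField dWaveFormFactor L)ᴴ * P) *ᵥ v)).re ≤ s * (star v ⬝ᵥ v).re) :=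
  fun L _ U N hN4 γ s hs hgapH hpair => floorProjectionData L U N hN4 γ s hs hgapH hpair

end Summit.HubbardSuperconductivity.HubbardSuperconductivity.Theorems.JosephsonMirror
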